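/-
Copyright: ideator seat ym-r3-idea-2 (gen 9), cell ym3-torus.  BC5 / tribunal-T3 WITNESS RUNG for the shared deciding crux
`RectangleTailL` (stmt-QuantumFields-23864) of the line-routes `RectangleDomination` (LINE 17) and `RandomisedStokes` (LINE 18).
Nothing is claimed beyond what the kernel checks below; no summit, rung or crux is proved here.
-/
import Literature.MathematicalPhysics.QuantumFieldTheory.Balaban1983to89.T3FinestHeightTail
import Literature.MathematicalPhysics.QuantumFieldTheory.Balaban1983to89.WilsonLoopLimit
import Summits.QuantumFields.YangMills.Theorems.SmallFieldWideningLargeFieldMassRefinementTailMassOfPerPlaquette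

/-!
# `RectangleTailL` — the `1 × 1` rung (BC5 witness of weakness, tribunal T3)

`RectangleTailL` (route file `Theses/RectangleDomination.lean`, item stmt-QuantumFields-23864, shared with
`Theses/RandomisedStokes.lean`) asks, for every contractible lattice rectangle with sides `a, b ≥ 1` of Bałaban's finest torus
`T^{(0)}_K` and every `0 < t ≤ 1`, the PERIMETER-law moderate-deviation bound
`Gibbs_K{t ≤ dist1(hol ∂rect)} ≤ C·β_K^A·(a+b)^A·exp(−(c·t²β_K/((a+b)(1+log(a+b))))^α)` uniformly in the cut-off `K`.

THIS FILE proves the body of `RectangleTailL` VERBATIM with the side hypotheses `1 ≤ a → 1 ≤ b` replaced by `a = 1 → b = 1`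
(the smallest rectangle = one plaquette, either orientation `μ ≠ ν`), with the explicit constants
`α = 1`, `c = (1 + log 2)/2`, `C = 2·e^{24}·c₀⁻³`, `A = 5` (`c₀ = c₀(SU(2)) ∈ (0,1]` the Haar small-ball constant):
`rectangleTailL_rung_one_one`.  Engine: the tree's Peierls–chessboard single-plaquette tail
`T3FinestHeightTail.gibbsMeasure_real_dist1_ge_le` (reflection positivity + [FrohlichIsraelLiebSimon1978] Thm 4.1, uniform in the
volume, `β ≥ 1`), the identification of the `1 × 1` rectangular holonomy with the plaquette variable (`pathHol_rectLoop_one_one_of_lt`,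
`dist1_pathHol_rectLoop_one_one_of_gt` — the reversed orientation is the inverse plaquette holonomy, `dist1` is inversion invariant),
and `β_K = (γ ε_K)⁻¹ ≥ 1` for `0 < γ ≤ 1`; `(√β)⁹ ≤ β⁵` is reused from the tree (`LargeFieldMassRefinementTail.sqrt_pow_nine_le_pow_five`).

WHY THIS IS A WITNESS AND NOT THE CRUX: for `a = b = 1` perimeter and area scalings coincide (`(a+b)(1+log(a+b)) = 2(1+log 2)`), so the
chessboard estimate — which for a general `a × b` rectangle only yields the AREA-type exponent `β t²/(ab)` minus an entropy `O(ab)` — is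
sharp here; the crux proper (`a + b → ∞` at perimeter·log scaling, uniformly in `β_K`) is untouched and is NOT in print
(locator note LIT-LINE6: nearest prints Garban–Sepúlveda IMRN 2023 = d = 4 abelian expectation; Göpfert–Mack CMP 82 = d = 3 abelian
expectation).  The rung lies outside any proved regime of the leaf `YM3TorusSU2` (nothing of the leaf is proved) and exercises the
route's tail functional at its base scale.

References: [FrohlichIsraelLiebSimon1978] Thm 4.1; [Balaban1985UV3] (11) p.258, (71) p.273; [ChatterjeeYMProb2019] §4 (loop variables).
-/

noncomputable section

open MeasureTheory
open Literature.MathematicalPhysics.QuantumFieldTheory.Balaban1983to89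
open Literature.MathematicalPhysics.QuantumFieldTheory.Balaban1983to89.T3ContinuumYM3Torus
open Literature.MathematicalPhysics.QuantumFieldTheory.Balaban1983to89.T3UnitScaleTilt
open Literature.MathematicalPhysics.QuantumFieldTheory.Balaban1983to89.T3UnitLawDensityEML
open Literature.MathematicalPhysics.QuantumFieldTheory.Balaban1983to89.Missing
open Summit.QuantumFields.YangMills.Theorems

namespace Summit.QuantumFields.YangMills.Theorems.RectangleDominationRectangleTailLRung

/-! ## 1. The `1 × 1` rectangular loop is the plaquette (group-valued version of `wilsonLoop_rectLoop_one_one`) -/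

section Loop

variable {P : Params} {G : Type*} [GaugeGroup G]

/-- For `μ < ν` the holonomy along `∂([x, x+e_μ] × [x, x+e_ν])` is the plaquette variable `U(∂p)`, `p = ⟨x, μ, ν⟩`
(B7 (9): `U(∂p) = U(x,x+e_μ)U(x+e_μ,x+e_μ+e_ν)U(x+e_ν,x+e_ν+e_μ)⁻¹U(x,x+e_ν)⁻¹`). [cite: Balaban1985Averaging, (9) p.19] -/
theorem pathHol_rectLoop_one_one_of_lt (U : GaugeField P 0 G) (x : Site P 0) {μ ν : Fin P.d} (h : μ < ν) :
    pathHol U (rectLoop x μ ν 1 1) = GaugeField.plaqHol U ⟨x, μ, ν, h⟩ := by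
  simp [rectLoop, fwdSeg, bwdSeg, pathHol, GaugeField.plaqHol, mul_assoc]

/-- For `ν < μ` the same loop is the boundary of the plaquette `⟨x, ν, μ⟩` traversed backwards: its holonomy is the INVERSE
plaquette variable. [cite: Balaban1985Averaging, (9) p.19] -/
theorem pathHol_rectLoop_one_one_of_gt (U : GaugeField P 0 G) (x : Site P 0) {μ ν : Fin P.d} (h : ν < μ) :
    pathHol U (rectLoop x μ ν 1 1) = (GaugeField.plaqHol U ⟨x, ν, μ, h⟩)⁻¹ := by
  simp [rectLoop, fwdSeg, bwdSeg, pathHol, GaugeField.plaqHol, mul_assoc, mul_inv_rev]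

/-- Hence `dist1(hol ∂rect_{1×1}) = dist1(U(∂p))` in the reversed orientation too (`dist1 g⁻¹ = dist1 g`, B7 (19)). [cite: Balaban1985Averaging, (19) p.21] -/
theorem dist1_pathHol_rectLoop_one_one_of_gt (U : GaugeField P 0 G) (x : Site P 0) {μ ν : Fin P.d} (h : ν < μ) :
    dist1 (pathHol U (rectLoop x μ ν 1 1)) = dist1 (GaugeField.plaqHol U ⟨x, ν, μ, h⟩) := by
  rw [pathHol_rectLoop_one_one_of_gt U x h, GaugeGroup.dist1_inv]

/-- The `1 × 1` tail event is a single-plaquette tail event, for either orientation `μ ≠ ν`. [folklore] -/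
theorem exists_plaq_setOf_rectLoop_one_one (x : Site P 0) {μ ν : Fin P.d} (hμν : μ ≠ ν) (t : ℝ) :
    ∃ p : Plaq P 0, {U : GaugeField P 0 G | t ≤ dist1 (pathHol U (rectLoop x μ ν 1 1))} =
      {U | t ≤ dist1 (GaugeField.plaqHol U p)} := by
  rcases lt_or_gt_of_ne hμν with h | h
  · exact ⟨⟨x, μ, ν, h⟩, by ext U; simp only [Set.mem_setOf_eq, pathHol_rectLoop_one_one_of_lt U x h]⟩
  · exact ⟨⟨x, ν, μ, h⟩, by ext U; simp only [Set.mem_setOf_eq, dist1_pathHol_rectLoop_one_one_of_gt U x h]⟩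

end Loop

/-! ## 2. The rung (arithmetic: `(√β)⁹ ≤ β⁵` is the tree's `LargeFieldMassRefinementTail.sqrt_pow_nine_le_pow_five`) -/

/-- **`RectangleTailL` ON `1 × 1` RECTANGLES (BC5 witness).**  The body of `Theses.RectangleDomination.RectangleTailL` with
`1 ≤ a → 1 ≤ b` specialised to `a = 1 → b = 1`, constants `α = 1`, `c = (1 + log 2)/2`, `C = 2e^{24}c₀⁻³`, `A = 5`:
for every `T3Family F`, `0 < γ ≤ 1`, run `K`, corner `x`, directions `μ ≠ ν` and `0 < t ≤ 1`,
`Gibbs_K{t ≤ dist1(hol ∂rect_{1×1})} ≤ C β_K^5 (1+1)^5 exp(−(c t² β_K/((1+1)(1+log(1+1))))^1) (= C·32·β_K^5·e^{−β_K t²/4})`.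
Chessboard single-plaquette tail of the tree + §1 + `β_K ≥ 1`; uniform in the volume and the cut-off.  The general `a × b` case
(perimeter·log scaling) is the OPEN crux and is not addressed. [cite: FrohlichIsraelLiebSimon1978, Thm. 4.1; Balaban1985UV3, (11) p.258 and (71) p.273] -/
theorem rectangleTailL_rung_one_one : ∀ (L : ℕ), ∃ (α c C : ℝ) (A : ℕ), 0 < α ∧ 0 < c ∧ 0 ≤ C ∧
    ∀ (F : T3Family) (γ : ℝ), F.L = L → 0 < γ → γ ≤ 1 →
      ∀ (K a b : ℕ) (x : Site (F.P K) 0) (μ ν : Fin (F.P K).d) (t : ℝ), μ ≠ ν → a = 1 → b = 1 →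
        2 * (a + b) < (F.P K).sitesPerDir 0 → 0 < t → t ≤ 1 →
          (gibbsK F ℰp γ K).real {U | t ≤ dist1 (pathHol U (rectLoop x μ ν a b))} ≤
            C * (F.scheme ℰp γ).β K ^ A * ((a : ℝ) + b) ^ A *
              Real.exp (-((c * (t ^ 2 * (F.scheme ℰp γ).β K / (((a : ℝ) + b) * (1 + Real.log ((a : ℝ) + b))))) ^ α)) := by
  obtain ⟨c₀, hc₀, _, h⟩ := T3FinestHeightTail.gibbsMeasure_real_dist1_ge_le (N := 2)
  intro L
  have hlog2 : 0 < 1 + Real.log 2 := by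
    have : 0 < Real.log 2 := Real.log_pos (by norm_num)
    linarith
  refine ⟨1, (1 + Real.log 2) / 2, 2 * Real.exp 24 * (c₀ ^ 3)⁻¹, 5, one_pos, by positivity, by positivity, ?_⟩
  intro F γ _ hγ hγ1 K a b x μ ν t hμν ha hb _ ht _
  subst ha; subst hb
  obtain ⟨p, hp⟩ := exists_plaq_setOf_rectLoop_one_one (G := Matrix.specialUnitaryGroup (Fin 2) ℂ) x hμν t
  rw [hp, gibbsK_eq]
  -- `β_K = (γ ε_K)⁻¹ ≥ 1` for `0 < γ ≤ 1`
  have hβ1 : 1 ≤ (F.scheme ℰp γ).β K := by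
    have hL1 : (1 : ℝ) ≤ (F.L : ℝ) := by exact_mod_cast F.hL.2.le
    have hLK : (1 : ℝ) ≤ (F.L : ℝ) ^ K := one_le_pow₀ hL1
    have hβ : (F.scheme ℰp γ).β K = (γ * ((F.L : ℝ)⁻¹) ^ K)⁻¹ := rfl
    rw [hβ, inv_pow]
    have hx0 : 0 < γ * ((F.L : ℝ) ^ K)⁻¹ := by positivity
    have hx1 : γ * ((F.L : ℝ) ^ K)⁻¹ ≤ 1 := by
      calc γ * ((F.L : ℝ) ^ K)⁻¹ ≤ 1 * 1 := by gcongr; exact inv_le_one_of_one_le₀ hLK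
        _ = 1 := one_mul 1
    exact one_le_inv_iff₀.mpr ⟨hx0, hx1⟩
  set β : ℝ := (F.scheme ℰp γ).β K with hβdef
  have hβ0 : 0 ≤ β := zero_le_one.trans hβ1
  -- the chessboard tail with `d = 3`, `N = 2`
  have h1 := h (F.P K) β hβ1 t ht.le p
  have hcard : Fintype.card {q : Fin (F.P K).d × Fin (F.P K).d // q.1 < q.2} = 3 := by
    rw [show (F.P K).d = 3 from rfl]; decide
  have hd3 : (F.P K).d = 3 := rfl
  rw [hcard, hd3] at h1
  refine h1.trans ?_
  -- normalise both sides
  have htwo : ((1 : ℕ) : ℝ) + ((1 : ℕ) : ℝ) = 2 := by norm_num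
  rw [htwo, Real.rpow_one]
  have hexp : (1 + Real.log 2) / 2 * (t ^ 2 * β / (2 * (1 + Real.log 2))) = β * t ^ 2 / (2 * ((2 : ℕ) : ℝ)) := by
    field_simp
    ring
  rw [hexp]
  have hE : 0 < Real.exp (-(β * t ^ 2 / (2 * ((2 : ℕ) : ℝ)))) := Real.exp_pos _
  have hsq : Real.sqrt β ^ (3 * (2 ^ 2 - 1)) ≤ β ^ 5 := by
    rw [show 3 * (2 ^ 2 - 1) = 9 by norm_num]
    exact LargeFieldMassRefinementTail.sqrt_pow_nine_le_pow_five hβ1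
  have h8 : Real.exp (8 * (3 : ℕ)) = Real.exp 24 := by norm_num
  rw [h8]
  calc 2 * Real.exp 24 * (c₀ ^ 3)⁻¹ * Real.sqrt β ^ (3 * (2 ^ 2 - 1)) * Real.exp (-(β * t ^ 2 / (2 * ((2 : ℕ) : ℝ))))
      ≤ 2 * Real.exp 24 * (c₀ ^ 3)⁻¹ * β ^ 5 * Real.exp (-(β * t ^ 2 / (2 * ((2 : ℕ) : ℝ)))) := by
        gcongr
    _ ≤ 2 * Real.exp 24 * (c₀ ^ 3)⁻¹ * β ^ 5 * (2 : ℝ) ^ 5 * Real.exp (-(β * t ^ 2 / (2 * ((2 : ℕ) : ℝ)))) := by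
        have hb5 : 0 ≤ 2 * Real.exp 24 * (c₀ ^ 3)⁻¹ * β ^ 5 := by positivity
        have : 2 * Real.exp 24 * (c₀ ^ 3)⁻¹ * β ^ 5 ≤ 2 * Real.exp 24 * (c₀ ^ 3)⁻¹ * β ^ 5 * (2 : ℝ) ^ 5 :=
          le_mul_of_one_le_right hb5 (by norm_num)
        exact mul_le_mul_of_nonneg_right this hE.le

end Summit.QuantumFields.YangMills.Theorems.RectangleDominationRectangleTailLRung
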